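import Summits.ResolutionOfSingularities.ResolutionOfSingularities.Theorems.EquisingularLiftEquisingularLiftNatDirDictAdaptedFrame
import HarnessLib

/-!
# [OURS · L1 W4.5(b) · EL♮(3)] T-DIRLIFT-UP, route C, ring core — DIRECTION COORDINATES in a quasi-regular 2-frame:
# `I/I²` is free on `(ℓ̄, m̄)`, a direction is `(αℓ + βm) + I²` with `(α, β)` unimodular mod `I`, unique up to a unit mod `I`

Crux chain w45b (cell `res-hironaka`, slot W4.5(b)), working crux **EL♮** = stmt-ResolutionOfSingularities-20038, child **EL♮(3)** =
stmt-ResolutionOfSingularities-20148, route EquisingularLift, line `sections`; object **T-DIRLIFT-UP** (the P1VB glue of a direction round,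
res-L1-w45b-plan-1 RULINGS 19:13:00Z / 19:14:55Z: ROUTE C = frame cocycles; spec `L/res-D-pv-051/TARGET-DIRLIFT.sig.md` 7aab4520d07b2a47,
entry-theorem text `TARGET-DIRLIFT-UP.sig.lean` 79182c5cfea32e6c), brick **C1 ring core** (used by C1 «direction ↦ unit cocycle + unimodular
columns» and by C3 «columns ↦ direction»). HONEST FRAMING: OURS; NOT a statement of any manuscript; AI-written, weaker than expert review.
No `sorry`; standard axioms. DEF-FREE. `--supports stmt-ResolutionOfSingularities-20148 --as helper`.

SETTING. `A` a commutative ring, `c = (ℓ, m) = (c 0, c 1)` a quasi-regular pair (Matsumura §16), `I = (ℓ, m)`. A DIRECTION along `I` is an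
ideal `D` with `I² ≤ D ≤ I` which is `(ℓ′) + I²` for some frame `(ℓ′, m′)` of `I` (T-DIRLIFT's `hdir` shape); its COORDINATES in the frame `c`
are `(α, β)` with `D = (αℓ + βm) + I²`.

WHAT (namespace `…Cruxes.EquisingularLiftNat.Sections`).
* `mem_of_linearComb_mem_sq` — **`I/I²` is free on `(ℓ̄, m̄)`**: `aℓ + bm ∈ I²` ⇒ `a, b ∈ I` (quasi-regularity in degree one).
* `span_sup_sq_eq_of_sub_mem` — `(v) + I² = (v′) + I²` when `v − v′ ∈ I²` (`v ∈ I`).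
* `exists_coords_of_mem` / **`exists_unimodular_coords_of_frame`** — every `ℓ′ ∈ I` is `αℓ + βm`; if `(ℓ′, m′)` generates `I` then `(α, β)` is
  UNIMODULAR MOD `I` (`xα + yβ ≡ 1`): the change-of-frame matrix is invertible mod `I` (2 × 2 Cauchy–Binet identity by `ring`).
* **`exists_unit_of_coords_eq`** — two unimodular coordinate pairs of the same direction differ by a UNIT of `A ⧸ I`:
  `(αℓ+βm) + I² = (α′ℓ+β′m) + I²` ⇒ `ᾱ′ = ū ᾱ`, `β̄′ = ū β̄` with `ū` a unit (the transition function of the direction LINE `D/I² ⊂ I/I²`).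
* **`exists_frame_of_unimodular`** (local rings) — in a local ring, a unimodular-mod-`I` pair has a unit coordinate, and `(αℓ + βm, m)` resp.
  `(αℓ + βm, ℓ)` is again a QUASI-REGULAR FRAME of `I` (part 1's `IsQuasiRegular.of_linearSubst`): coordinates ↦ the `hdir` shape
  `D = (c′ 0) + (c′ 1)²`.

References: H. Matsumura, *Commutative Ring Theory* (1986), §16 Thm. 16.2; The Stacks Project, Tag 063H (conormal module of a quasi-regular
ideal is free) — through the tree (Literature `QuasiRegularSequences`, part 1 p555912 `IsQuasiRegular.of_linearSubst` / `span_range_fin_two`).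
-/

noncomputable section

open IsLocalRing
open Literature.AlgebraicGeometry.Resolution

set_option linter.dupNamespace false -- mandated namespace `Summit.<Summit>.<Problem>` of this single-conjunct summit

namespace Summit.ResolutionOfSingularities.ResolutionOfSingularities.Cruxes.EquisingularLiftNat.Sections

universe u

variable {A : Type u} [CommRing A]

/-! ## 1. `I/I²` is free on a quasi-regular pair -/

open MvPolynomial in
/-- **Quasi-regularity in degree one**: for a quasi-regular pair `c = (ℓ, m)`, `I = (ℓ, m)`: if `aℓ + bm ∈ I²` then `a ∈ I` and `b ∈ I` — the
classes `ℓ̄, m̄` are a basis of `I/I²`. [cite: Matsumura1987, §16 Definition p. 124 and Thm. 16.2] -/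
theorem mem_of_linearComb_mem_sq {c : Fin 2 → A} (hc : IsQuasiRegular c) {a b : A}
    (h : a * c 0 + b * c 1 ∈ Ideal.span (Set.range c) ^ 2) : a ∈ Ideal.span (Set.range c) ∧ b ∈ Ideal.span (Set.range c) := by
  -- the linear form `F = a X₀ + b X₁`
  set F : MvPolynomial (Fin 2) A := C a * X 0 + C b * X 1 with hF
  have hFhom : F.IsHomogeneous 1 := by
    rw [hF]
    exact ((isHomogeneous_X A 0).C_mul a).add ((isHomogeneous_X A 1).C_mul b)
  have heval : eval c F = a * c 0 + b * c 1 := by simp [hF]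
  have hcoeff := (isQuasiRegular_def c).mp hc 1 F hFhom (by rw [heval]; exact h)
  have ha : F.coeff (Finsupp.single 0 1) = a := by
    rw [hF, coeff_add, coeff_C_mul, coeff_C_mul, coeff_X, coeff_X]
    simp [Finsupp.single_eq_single_iff]
  have hb : F.coeff (Finsupp.single 1 1) = b := by
    rw [hF, coeff_add, coeff_C_mul, coeff_C_mul, coeff_X, coeff_X]
    simp [Finsupp.single_eq_single_iff]
  exact ⟨ha ▸ hcoeff _, hb ▸ hcoeff _⟩

/-- `(v) + I² = (v′) + I²` whenever `v − v′ ∈ I²`. [folklore] -/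
theorem span_sup_sq_eq_of_sub_mem {I : Ideal A} {v v' : A} (h : v - v' ∈ I ^ 2) :
    Ideal.span {v} ⊔ I ^ 2 = Ideal.span {v'} ⊔ I ^ 2 := by
  apply le_antisymm
  · refine sup_le ?_ le_sup_right
    rw [Ideal.span_singleton_le_iff_mem]
    have hv : v = v' + (v - v') := by ring
    rw [hv]
    exact Ideal.add_mem _ (Ideal.mem_sup_left (Ideal.mem_span_singleton_self _)) (Ideal.mem_sup_right h)
  · refine sup_le ?_ le_sup_right
    rw [Ideal.span_singleton_le_iff_mem]
    have hv : v' = v - (v - v') := by ring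
    rw [hv]
    exact Ideal.sub_mem _ (Ideal.mem_sup_left (Ideal.mem_span_singleton_self _)) (Ideal.mem_sup_right h)

/-! ## 2. Coordinates of a direction; unimodularity -/

/-- Every element of `I = (ℓ, m)` has coordinates: `v = αℓ + βm`. [folklore] -/
theorem exists_coords_of_mem (c : Fin 2 → A) {v : A} (hv : v ∈ Ideal.span (Set.range c)) :
    ∃ α β : A, v = α * c 0 + β * c 1 := by
  rw [span_range_fin_two, Ideal.mem_span_pair] at hv
  obtain ⟨α, β, h⟩ := hv
  exact ⟨α, β, h.symm⟩

/-- **Unimodularity of the coordinates of a frame member.** If `c = (ℓ, m)` is quasi-regular, `I = (ℓ, m)`, and `c′ = (ℓ′, m′)` is another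
generating pair of `I` with `ℓ′ = αℓ + βm`, then `(α, β)` is unimodular modulo `I`: `xα + yβ − 1 ∈ I` for some `x, y` (the change-of-frame
matrix reduces to an invertible matrix over `A ⧸ I`, its rows are unimodular). [cite: StacksProject, Tag 063H] -/
theorem exists_unimodular_coords_of_frame {c : Fin 2 → A} (hc : IsQuasiRegular c) (c' : Fin 2 → A)
    (hc' : Ideal.span (Set.range c') = Ideal.span (Set.range c)) {α β : A} (h0 : c' 0 = α * c 0 + β * c 1) :
    ∃ x y : A, x * α + y * β - 1 ∈ Ideal.span (Set.range c) := by
  -- coordinates of `m′` and of `ℓ, m` in the frame `c′`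
  obtain ⟨γ, δ, h1⟩ := exists_coords_of_mem c
    (show c' 1 ∈ Ideal.span (Set.range c) from hc' ▸ Ideal.subset_span (Set.mem_range_self 1))
  obtain ⟨p, q, hp⟩ := exists_coords_of_mem c'
    (show c 0 ∈ Ideal.span (Set.range c') from hc'.symm ▸ Ideal.subset_span (Set.mem_range_self 0))
  obtain ⟨r, s, hr⟩ := exists_coords_of_mem c'
    (show c 1 ∈ Ideal.span (Set.range c') from hc'.symm ▸ Ideal.subset_span (Set.mem_range_self 1))
  -- `ℓ = p ℓ′ + q m′ = (pα + qγ) ℓ + (pβ + qδ) m`, so `pα + qγ ≡ 1`, `pβ + qδ ≡ 0`; same for `m`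
  have hℓ : (p * α + q * γ - 1) * c 0 + (p * β + q * δ) * c 1 ∈ Ideal.span (Set.range c) ^ 2 := by
    have h : (p * α + q * γ - 1) * c 0 + (p * β + q * δ) * c 1 = 0 := by
      have := hp; rw [h0, h1] at this; linear_combination -this
    rw [h]; exact zero_mem _
  have hm : (r * α + s * γ) * c 0 + (r * β + s * δ - 1) * c 1 ∈ Ideal.span (Set.range c) ^ 2 := by
    have h : (r * α + s * γ) * c 0 + (r * β + s * δ - 1) * c 1 = 0 := by
      have := hr; rw [h0, h1] at this; linear_combination -this
    rw [h]; exact zero_mem _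
  obtain ⟨h11, h12⟩ := mem_of_linearComb_mem_sq hc hℓ
  obtain ⟨-, h22⟩ := mem_of_linearComb_mem_sq hc hm
  -- `N M ≡ 1` for `M = [[α, β], [γ, δ]]`, `N = [[p, q], [r, s]]`; taking determinants (2 × 2 Cauchy–Binet) `det M · det N ≡ 1`, and
  -- `α (δ det N) + β (−γ det N) = det M · det N`
  refine ⟨δ * (p * s - q * r), -(γ * (p * s - q * r)), ?_⟩
  have hT : δ * (p * s - q * r) * α + -(γ * (p * s - q * r)) * β - 1 =
      (p * α + q * γ - 1) * (r * β + s * δ - 1) + (p * α + q * γ - 1) + (r * β + s * δ - 1) - (p * β + q * δ) * (r * α + s * γ) := by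
    ring
  rw [hT]
  exact Ideal.sub_mem _ (Ideal.add_mem _ (Ideal.add_mem _ (Ideal.mul_mem_left _ _ h22) h11) h22) (Ideal.mul_mem_right _ _ h12)

/-- **A direction has unimodular coordinates.** `c = (ℓ, m)` quasi-regular, `I = (ℓ, m)`, and `D` a direction given in the `hdir` shape
`D = (ℓ′) + (m′²)` for a frame `c′ = (ℓ′, m′)` of `I`. Then `D = (αℓ + βm) + I²` with `(α, β)` unimodular mod `I`. [cite: StacksProject, Tag 063H] -/
theorem exists_unimodular_coords_of_direction {c : Fin 2 → A} (hc : IsQuasiRegular c) (c' : Fin 2 → A)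
    (hc' : Ideal.span (Set.range c') = Ideal.span (Set.range c)) {D : Ideal A}
    (hD : D = Ideal.span {c' 0} ⊔ Ideal.span {c' 1 * c' 1}) :
    ∃ α β : A, D = Ideal.span {α * c 0 + β * c 1} ⊔ Ideal.span (Set.range c) ^ 2 ∧
      ∃ x y : A, x * α + y * β - 1 ∈ Ideal.span (Set.range c) := by
  obtain ⟨α, β, h0⟩ := exists_coords_of_mem c
    (show c' 0 ∈ Ideal.span (Set.range c) from hc' ▸ Ideal.subset_span (Set.mem_range_self 0))
  refine ⟨α, β, ?_, exists_unimodular_coords_of_frame hc c' hc' h0⟩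
  -- `(ℓ′) + (m′²) = (ℓ′) + I²` since `I² = (ℓ′², ℓ′m′, m′²) ≤ (ℓ′) + (m′²)` and `m′² ∈ I²`
  rw [hD, ← h0]
  have hI' : Ideal.span (Set.range c) = Ideal.span {c' 0, c' 1} := by rw [← hc', span_range_fin_two]
  apply le_antisymm
  · refine sup_le le_sup_left ?_
    rw [Ideal.span_singleton_le_iff_mem]
    refine Ideal.mem_sup_right ?_
    rw [pow_two]
    exact Ideal.mul_mem_mul (hI' ▸ Ideal.subset_span (by simp)) (hI' ▸ Ideal.subset_span (by simp))
  · refine sup_le le_sup_left ?_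
    rw [hI', pow_two, Ideal.span_pair_mul_span_pair]
    refine Ideal.span_le.mpr ?_
    intro v hv
    simp only [Set.mem_insert_iff, Set.mem_singleton_iff] at hv
    rcases hv with rfl | rfl | rfl | rfl
    · exact Ideal.mem_sup_left (Ideal.mem_span_singleton'.mpr ⟨c' 0, rfl⟩)
    · exact Ideal.mem_sup_left (Ideal.mem_span_singleton'.mpr ⟨c' 1, by ring⟩)
    · exact Ideal.mem_sup_left (Ideal.mem_span_singleton'.mpr ⟨c' 1, rfl⟩)
    · exact Ideal.mem_sup_right (Ideal.mem_span_singleton_self _)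

/-! ## 3. Two coordinate pairs of one direction differ by a unit mod `I` -/

/-- **The transition unit of a direction.** If `(αℓ + βm) + I² = (α′ℓ + β′m) + I²` with `(α, β)` unimodular mod `I`, then `α′ ≡ uα`,
`β′ ≡ uβ`, `α ≡ u′α′`, `β ≡ u′β′ (mod I)` with `u u′ ≡ 1 (mod I)` — a UNIT of `A ⧸ I`. [cite: StacksProject, Tag 063H] -/
theorem exists_unit_of_coords_eq {c : Fin 2 → A} (hc : IsQuasiRegular c) {α β α' β' : A}
    (h : Ideal.span {α * c 0 + β * c 1} ⊔ Ideal.span (Set.range c) ^ 2 =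
      Ideal.span {α' * c 0 + β' * c 1} ⊔ Ideal.span (Set.range c) ^ 2)
    (hu : ∃ x y : A, x * α + y * β - 1 ∈ Ideal.span (Set.range c)) :
    ∃ u u' : A, α' - u * α ∈ Ideal.span (Set.range c) ∧ β' - u * β ∈ Ideal.span (Set.range c) ∧
      α - u' * α' ∈ Ideal.span (Set.range c) ∧ β - u' * β' ∈ Ideal.span (Set.range c) ∧
      u * u' - 1 ∈ Ideal.span (Set.range c) := by
  -- `α′ℓ + β′m = u (αℓ + βm) + w`, `w ∈ I²`
  have key : ∀ {α β α' β' : A}, Ideal.span {α * c 0 + β * c 1} ⊔ Ideal.span (Set.range c) ^ 2 =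
      Ideal.span {α' * c 0 + β' * c 1} ⊔ Ideal.span (Set.range c) ^ 2 →
      ∃ u : A, α' - u * α ∈ Ideal.span (Set.range c) ∧ β' - u * β ∈ Ideal.span (Set.range c) := by
    intro α β α' β' h
    have hmem : α' * c 0 + β' * c 1 ∈ Ideal.span {α * c 0 + β * c 1} ⊔ Ideal.span (Set.range c) ^ 2 := by
      rw [h]; exact Ideal.mem_sup_left (Ideal.mem_span_singleton_self _)
    rw [Ideal.mem_span_singleton_sup] at hmem
    obtain ⟨u, w, hw, huw⟩ := hmem
    refine ⟨u, ?_⟩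
    have hlin : (α' - u * α) * c 0 + (β' - u * β) * c 1 ∈ Ideal.span (Set.range c) ^ 2 := by
      have hw' : (α' - u * α) * c 0 + (β' - u * β) * c 1 = w := by linear_combination -huw
      rw [hw']; exact hw
    exact mem_of_linearComb_mem_sq hc hlin
  obtain ⟨u, hu1, hu2⟩ := key h
  obtain ⟨u', hu1', hu2'⟩ := key h.symm
  refine ⟨u, u', hu1, hu2, hu1', hu2', ?_⟩
  -- `α ≡ u′α′ ≡ u′u α`, `β ≡ u′u β`, and `xα + yβ ≡ 1` ⇒ `u u′ ≡ 1`
  obtain ⟨x, y, hxy⟩ := hu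
  have ha : (1 - u * u') * α ∈ Ideal.span (Set.range c) := by
    have h1 : (1 - u * u') * α = (α - u' * α') + u' * (α' - u * α) := by ring
    rw [h1]; exact Ideal.add_mem _ hu1' (Ideal.mul_mem_left _ _ hu1)
  have hb : (1 - u * u') * β ∈ Ideal.span (Set.range c) := by
    have h1 : (1 - u * u') * β = (β - u' * β') + u' * (β' - u * β) := by ring
    rw [h1]; exact Ideal.add_mem _ hu2' (Ideal.mul_mem_left _ _ hu2)
  have h2 : u * u' - 1 = (1 - u * u') * (x * α + y * β - 1) - x * ((1 - u * u') * α) - y * ((1 - u * u') * β) := by ring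
  rw [h2]
  exact Ideal.sub_mem _ (Ideal.sub_mem _ (Ideal.mul_mem_left _ _ hxy) (Ideal.mul_mem_left _ _ ha)) (Ideal.mul_mem_left _ _ hb)

/-! ## 4. Local rings: from unimodular coordinates back to a quasi-regular frame (`hdir` shape) -/

/-- In a local ring, a pair unimodular modulo a proper ideal has a unit coordinate. [folklore] -/
theorem isUnit_or_isUnit_of_unimodular [IsLocalRing A] {I : Ideal A} (hI : I ≤ maximalIdeal A) {α β : A}
    (hu : ∃ x y : A, x * α + y * β - 1 ∈ I) : IsUnit α ∨ IsUnit β := by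
  by_contra h
  push Not at h
  obtain ⟨x, y, hxy⟩ := hu
  have hα : α ∈ maximalIdeal A := (mem_maximalIdeal _).mpr (mem_nonunits_iff.mpr h.1)
  have hβ : β ∈ maximalIdeal A := (mem_maximalIdeal _).mpr (mem_nonunits_iff.mpr h.2)
  have h1 : (1 : A) ∈ maximalIdeal A := by
    have h2 : (1 : A) = (x * α + y * β) - (x * α + y * β - 1) := by ring
    rw [h2]
    exact Ideal.sub_mem _ (Ideal.add_mem _ (Ideal.mul_mem_left _ _ hα) (Ideal.mul_mem_left _ _ hβ)) (hI hxy)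
  exact (maximalIdeal.isMaximal A).ne_top (Ideal.eq_top_of_isUnit_mem _ h1 isUnit_one)

open MvPolynomial in
/-- Scaling one member of a quasi-regular pair by a unit keeps it quasi-regular. [cite: Matsumura1987, §16 Definition p. 124] -/
theorem isQuasiRegular_pair_unit_mul {c : Fin 2 → A} (hc : IsQuasiRegular c) {α : A} (hα : IsUnit α) :
    IsQuasiRegular ![α * c 0, c 1] := by
  obtain ⟨a, rfl⟩ := hα
  refine IsQuasiRegular.of_linearSubst (x := c) ![C (a : A) * X 0, X 1] ![C (↑a⁻¹ : A) * X 0, X 1] ?_ ?_ ?_ ?_ hc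
  · intro i; fin_cases i
    · simpa using (isHomogeneous_X A (0 : Fin 2)).C_mul (a : A)
    · simpa using isHomogeneous_X A _
  · intro i; fin_cases i
    · simp only [Fin.zero_eta, Fin.isValue, Matrix.cons_val_zero, map_mul, bind₁_C_right, bind₁_X_right]
      rw [← mul_assoc, ← map_mul, Units.mul_inv, map_one, one_mul]
    · simp [bind₁_X_right]
  · intro i; fin_cases i <;> simp
  · -- spans agree: `α` is a unit
    rw [span_range_fin_two, span_range_fin_two c]
    simp only [Matrix.cons_val_zero, Matrix.cons_val_one]
    apply le_antisymm <;> rw [Ideal.span_le] <;> rintro v (rfl | rfl)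
    · exact Ideal.mul_mem_left _ _ (Ideal.subset_span (by simp))
    · exact Ideal.subset_span (by simp)
    · have h : c 0 = (↑a⁻¹ : A) * ((a : A) * c 0) := by rw [← mul_assoc, Units.inv_mul, one_mul]
      rw [SetLike.mem_coe, h]
      exact Ideal.mul_mem_left _ _ (Ideal.subset_span (by simp))
    · exact Ideal.subset_span (by simp)

/-- **From unimodular coordinates to a quasi-regular frame (local rings).** `A` local, `c = (ℓ, m)` quasi-regular with `I = (ℓ, m)` proper,
`(α, β)` unimodular mod `I`. Then there is a quasi-regular frame `c′` of `I` with `c′ 0 = αℓ + βm`, so that the direction with coordinates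
`(α, β)` is `(c′ 0) + (c′ 1 · c′ 1)` — T-DIRLIFT's `hdir` shape. [cite: Matsumura1987, §16 Definition p. 124] -/
theorem exists_frame_of_unimodular [IsLocalRing A] {c : Fin 2 → A} (hc : IsQuasiRegular c)
    (hI : Ideal.span (Set.range c) ≤ maximalIdeal A) {α β : A} (hu : ∃ x y : A, x * α + y * β - 1 ∈ Ideal.span (Set.range c)) :
    ∃ c' : Fin 2 → A, Ideal.span (Set.range c') = Ideal.span (Set.range c) ∧ IsQuasiRegular c' ∧ c' 0 = α * c 0 + β * c 1 ∧
      Ideal.span {α * c 0 + β * c 1} ⊔ Ideal.span (Set.range c) ^ 2 = Ideal.span {c' 0} ⊔ Ideal.span {c' 1 * c' 1} := by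
  -- the `hdir` shape from any frame `c′` with `c′ 0 = v`
  have hshape : ∀ c' : Fin 2 → A, Ideal.span (Set.range c') = Ideal.span (Set.range c) → c' 0 = α * c 0 + β * c 1 →
      Ideal.span {α * c 0 + β * c 1} ⊔ Ideal.span (Set.range c) ^ 2 = Ideal.span {c' 0} ⊔ Ideal.span {c' 1 * c' 1} := by
    intro c' hc' h0
    obtain ⟨α', β', hD, -⟩ := exists_unimodular_coords_of_direction hc c' hc' (D := Ideal.span {c' 0} ⊔ Ideal.span {c' 1 * c' 1}) rfl
    -- `hD : (c′0) + (c′1²) = (α′ℓ+β′m) + I²`; and `c′ 0 = αℓ + βm` lies in it, so the two direction ideals agree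
    rw [hD]
    have hmem : α * c 0 + β * c 1 ∈ Ideal.span {α' * c 0 + β' * c 1} ⊔ Ideal.span (Set.range c) ^ 2 := by
      rw [← hD, ← h0]; exact Ideal.mem_sup_left (Ideal.mem_span_singleton_self _)
    rw [Ideal.mem_span_singleton_sup] at hmem
    obtain ⟨u, w, hw, huw⟩ := hmem
    -- `αℓ+βm = u(α′ℓ+β′m) + w`; conversely `α′ℓ+β′m ∈ (c′0) + (c′1²) = (αℓ+βm) + …` gives the other inclusion; use `hD` twice
    apply le_antisymm
    · refine sup_le ?_ le_sup_right
      rw [Ideal.span_singleton_le_iff_mem, Ideal.mem_span_singleton_sup]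
      exact ⟨u, w, hw, huw⟩
    · rw [← hD]
      refine sup_le ?_ ?_
      · rw [h0]; exact le_sup_left
      · rw [Ideal.span_singleton_le_iff_mem]
        refine Ideal.mem_sup_right ?_
        rw [pow_two]
        have h1 : c' 1 ∈ Ideal.span (Set.range c) := hc' ▸ Ideal.subset_span (Set.mem_range_self 1)
        exact Ideal.mul_mem_mul h1 h1
  rcases isUnit_or_isUnit_of_unimodular hI hu with hα | hβ
  · -- `α` a unit: `c′ = (αℓ + βm, m)` = sub_mul after scaling
    refine ⟨![α * c 0 + β * c 1, c 1], ?_, ?_, rfl, hshape _ ?_ rfl⟩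
    · have h := span_range_pair_sub_mul ![α * c 0, c 1] (-β)
      simp only [Matrix.cons_val_zero, Matrix.cons_val_one, neg_mul, sub_neg_eq_add] at h
      rw [h]
      have h2 := span_range_pair_sub_mul ![α * c 0, c 1] 0
      have hqr := isQuasiRegular_pair_unit_mul hc hα
      -- span of `(αℓ, m)` is `I`
      rw [span_range_fin_two, span_range_fin_two c]
      simp only [Matrix.cons_val_zero, Matrix.cons_val_one]
      obtain ⟨a, rfl⟩ := hα
      apply le_antisymm <;> rw [Ideal.span_le] <;> rintro v (rfl | rfl)
      · exact Ideal.mul_mem_left _ _ (Ideal.subset_span (by simp))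
      · exact Ideal.subset_span (by simp)
      · have h3 : c 0 = (↑a⁻¹ : A) * ((a : A) * c 0) := by rw [← mul_assoc, Units.inv_mul, one_mul]
        rw [SetLike.mem_coe, h3]
        exact Ideal.mul_mem_left _ _ (Ideal.subset_span (by simp))
      · exact Ideal.subset_span (by simp)
    · have h := isQuasiRegular_pair_sub_mul (isQuasiRegular_pair_unit_mul hc hα) (-β)
      simp only [Matrix.cons_val_zero, Matrix.cons_val_one, neg_mul, sub_neg_eq_add] at h
      exact h
    · have h := span_range_pair_sub_mul ![α * c 0, c 1] (-β)
      simp only [Matrix.cons_val_zero, Matrix.cons_val_one, neg_mul, sub_neg_eq_add] at h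
      rw [h, span_range_fin_two, span_range_fin_two c]
      simp only [Matrix.cons_val_zero, Matrix.cons_val_one]
      obtain ⟨a, rfl⟩ := hα
      apply le_antisymm <;> rw [Ideal.span_le] <;> rintro v (rfl | rfl)
      · exact Ideal.mul_mem_left _ _ (Ideal.subset_span (by simp))
      · exact Ideal.subset_span (by simp)
      · have h3 : c 0 = (↑a⁻¹ : A) * ((a : A) * c 0) := by rw [← mul_assoc, Units.inv_mul, one_mul]
        rw [SetLike.mem_coe, h3]
        exact Ideal.mul_mem_left _ _ (Ideal.subset_span (by simp))
      · exact Ideal.subset_span (by simp)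
  · -- `β` a unit: swap, `c′ = (βm + αℓ, ℓ)`
    have hcs : IsQuasiRegular ![c 1, c 0] := isQuasiRegular_pair_swap' hc
    have hqr := isQuasiRegular_pair_sub_mul (isQuasiRegular_pair_unit_mul hcs hβ) (-α)
    simp only [Matrix.cons_val_zero, Matrix.cons_val_one, neg_mul, sub_neg_eq_add] at hqr
    have hspan : Ideal.span (Set.range ![β * c 1 + α * c 0, c 0]) = Ideal.span (Set.range c) := by
      have h := span_range_pair_sub_mul ![β * c 1, c 0] (-α)
      simp only [Matrix.cons_val_zero, Matrix.cons_val_one, neg_mul, sub_neg_eq_add] at h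
      rw [h, span_range_fin_two, span_range_fin_two c]
      simp only [Matrix.cons_val_zero, Matrix.cons_val_one]
      obtain ⟨b, rfl⟩ := hβ
      apply le_antisymm <;> rw [Ideal.span_le] <;> rintro v (rfl | rfl)
      · exact Ideal.mul_mem_left _ _ (Ideal.subset_span (by simp))
      · exact Ideal.subset_span (by simp)
      · exact Ideal.subset_span (by simp)
      · have h3 : c 1 = (↑b⁻¹ : A) * ((b : A) * c 1) := by rw [← mul_assoc, Units.inv_mul, one_mul]
        rw [SetLike.mem_coe, h3]
        exact Ideal.mul_mem_left _ _ (Ideal.subset_span (by simp))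
    have h0 : (![β * c 1 + α * c 0, c 0] : Fin 2 → A) 0 = α * c 0 + β * c 1 := by
      simp only [Matrix.cons_val_zero]; ring
    exact ⟨![β * c 1 + α * c 0, c 0], hspan, hqr, h0, hshape _ hspan h0⟩

end Summit.ResolutionOfSingularities.ResolutionOfSingularities.Cruxes.EquisingularLiftNat.Sections

end
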